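import Summits.QuantumAdvantage.QuantumAdvantage.Theorems.CubicForrelationNearExactIsExactTenZCount
import Summits.QuantumAdvantage.QuantumAdvantage.Theorems.CubicForrelationNearExactIsExactTenCharacter
import Summits.QuantumAdvantage.QuantumAdvantage.Theorems.CubicForrelationNearExactIsExactIsolationSmallN

/-!
# Crux `CubicForrelation.NearExactIsExact` (stmt-QuantumAdvantage-14043) — isolation at `θ = 7/8` on 10 bits:
a SECOND, INDEPENDENT proof by the digit method (`isolation_ten_78_digital`)

Seat `b2b-cforr-cert` (n = 10, θ = 7/8 certificate rung; seat 2), file 5 (assembly) of the digit-method proof.  HONEST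
FRAMING: the value here is a THEOREM about cubic pairs on 10 bits — NOT summit progress.  The statement — **for all cubic
`f, g : 𝔽₂¹⁰ → 𝔽₂`, `Φ(f,g) > 7/8 ⇒ Φ(f,g) = 1`** — was FIRST landed by the parallel seat 1 as `isolation_ten_78`
(`…TenIsolation78Final.lean`, p179951: the census hypothesis CENSUS₁₀′ discharged by a Fourier/energy argument on the lead's
cell normal form `g = E ⊕ y₉D ⊕ y₁₀Q`).  THIS file gives an independent certification by a structurally different route
that never uses the cell normal form (`ten_unbalanced_cells`): mixed 2-adic digits of `W_g/16` (`TenDigits`), partner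
rigidity `f = bit₂(W_g/16)` (`TenPartner`), the affine character of the second digit (`TenCharacter`), the self-duality of
the residual and the derivative count (`TenZCount`).  Inputs from the tree: `ten_window_derivative_unbalanced` (balanced split
empty), `stub_axParity`, `bb_rmWeight_holds`, `stub_quadWalshPlateau`, `stub_derivDegree`.  No census, no `native_decide`:
axioms are the standard three.

Proof (paper version: seat folder `PROOF.md`).  In the window `7/8 < Φ < 1` both `(f,g)` and `(g,f)` are split
(`ten_window_derivative_unbalanced`: `W_g = 16u`, `[u odd] = b₀ ⊕ c·x`, `c ≠ 0`, `D_c g` unbalanced).  With the residuals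
`τ = u − 2(−1)^f`, `τ' = u' − 2(−1)^g` (`Σ τ² = Σ τ'² = 2¹³(1−Φ) < 1024`):
1. (`TenPartner`) `f = bit₂(u)`, `τ ≡ 0 (mod 8)` off `L = {u odd}`, `τ ≡ χ (mod 8)` on `L` (`χ = ±1` the sign of `bit₁(u)`);
   the same for `(g,f)`.
2. (`TenCharacter`) the character sums `ρ̂'(x) = Σ_{y∈L'} χ'(y)(−1)^{x·y}` vanish off two points `x₁ ≠ x₂`, where they are `±512`.
3. (here) `Σ_{y∈L'} τ'χ' ≥ 427` (pointwise `6τ'χ' + τ'² ≥ 7` from `τ' ≡ χ' (mod 8)`, and `Σ_{L'} τ'² < 1024`); by the self-duality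
   `τ̂ = −32τ'` (`tz_fourier_link`) and adjointness, `Σ_x τ(x)ρ̂'(x) = −32 Σ_{L'} τ'χ'`, whence `|τ(x₁)| + |τ(x₂)| ≥ 27`;
   the cost table (`τ ∈ ±1 + 8ℤ` on `L`, `τ ∈ 8ℤ` on `H`, total cost `Σ(τ² − [x∈L]) < 512`) then forces `{|τ(x₁)|,|τ(x₂)|} ∈
   {{15,15},{15,16}}` (`ts_key`), every OTHER point of `H` to have `τ = 0`, and not both `xᵢ` in `H`.
4. (`TenZCount`) the derivative count `2(−1)^{b₀}A_c = Σ_{x∈H}(4(−1)^f τ + τ²)` gives `A_c = 0` (no `H`-defect) — contradicting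
   the unbalanced derivative — or `A_c ∈ {±96, ±160}` (one `H`-defect `τ = ±16`) — contradicting Dickson (`A_c ∈ {0, ±2^s}`).
References: C. Carlet, *Boolean Functions for Cryptography and Coding Theory*, CUP 2021, §2.2–2.3, §4.1, §6.1; F. J. MacWilliams,
N. J. A. Sloane (1977) Ch. 13–15; S. Aaronson, A. Ambainis, SIAM J. Comput. 47 (2018) §1.1.1.
-/

set_option linter.dupNamespace false -- D-0017: single-problem summit ⇒ `QuantumAdvantage.QuantumAdvantage` by design

noncomputable section

namespace Summit.QuantumAdvantage.QuantumAdvantage.Theorems.CubicForrelation.NearExactIsExact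

open Finset
open Literature.Computability.QuantumComplexity
open Literature.Computability.QuantumComplexity.BuzetChailloux (bxor zeroVec signOf_sq twist_zeroVec_right bxor_zeroVec)
open Literature.Computability.QuantumComplexity.DerivativeWalsh (W)
open Summit.QuantumAdvantage.QuantumAdvantage.Theorems.SignedCubicForrelationNotPrBPP.Negative.HalfQuad (forrelation_comm)

/-! ### Integer arithmetic of the cost table -/

/-- Pointwise input of step 3: `τ' ≡ χ' (mod 8)`, `χ' = ±1` ⇒ `6τ'χ' + τ'² ≥ 7` (`τ' = χ'(1+8k)`:
`6(1+8k) + (1+8k)² = 7 + 64k(k+1)`). [this work] -/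
theorem ts_pair_lemma (t c : ℤ) (hc : c = 1 ∨ c = -1) (h : (8 : ℤ) ∣ t - c) : 7 ≤ 6 * (t * c) + t ^ 2 := by
  obtain ⟨k, hk⟩ := h
  have ht : t = c + 8 * k := by linarith
  have hk1 : 0 ≤ k * (k + 1) := by
    rcases le_or_gt 0 k with h0 | h0
    · nlinarith
    · have : k + 1 ≤ 0 := by omega
      nlinarith
  have hk2 : 0 ≤ k * (k - 1) := by
    rcases le_or_gt 1 k with h0 | h0
    · nlinarith
    · have : k ≤ 0 := by omega
      nlinarith
  rcases hc with rfl | rfl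
  · rw [ht]; nlinarith [hk1]
  · rw [ht]; nlinarith [hk2]

/-- The candidate values of a residual of size `5 ≤ |t| ≤ 22`: on `L` (`e = 1`, `t ≡ ±1 (mod 8)`) `t ∈ ±{7,9,15,17}`, on `H`
(`e = 0`, `t ≡ 0 (mod 8)`) `t ∈ ±{8,16}`. [this work] -/
theorem ts_cand (t e c : ℤ) (he : e = 0 ∨ e = 1) (hc : c = 1 ∨ c = -1) (hd : (8 : ℤ) ∣ t - e * c)
    (h5 : 5 ≤ |t|) (h22 : |t| ≤ 22) :
    (e = 0 ∧ (t = 8 ∨ t = -8 ∨ t = 16 ∨ t = -16)) ∨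
      (e = 1 ∧ (t = 7 ∨ t = -7 ∨ t = 9 ∨ t = -9 ∨ t = 15 ∨ t = -15 ∨ t = 17 ∨ t = -17)) := by
  rcases abs_cases t with ⟨ha, _⟩ | ⟨ha, _⟩ <;> rw [ha] at h5 h22 <;> rcases he with rfl | rfl <;>
    rcases hc with rfl | rfl <;> omega

/-- **The cost table argument.** Two residual values with `|t₁| + |t₂| ≥ 27`, costs `tᵢ² − eᵢ` (`eᵢ = [xᵢ ∈ L]`) summing to
`< 512`, and the residues of step 1, must be `{15,15}` (both on `L`) or `{15,16}`: total cost `≥ 448`, an `H`-point has `t² = 256`,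
and not both points lie on `H`. [this work] -/
theorem ts_key (t₁ t₂ e₁ e₂ c₁ c₂ : ℤ) (he₁ : e₁ = 0 ∨ e₁ = 1) (he₂ : e₂ = 0 ∨ e₂ = 1) (hc₁ : c₁ = 1 ∨ c₁ = -1)
    (hc₂ : c₂ = 1 ∨ c₂ = -1) (hd₁ : (8 : ℤ) ∣ t₁ - e₁ * c₁) (hd₂ : (8 : ℤ) ∣ t₂ - e₂ * c₂)
    (hsum : 27 ≤ |t₁| + |t₂|) (hcost : t₁ ^ 2 - e₁ + (t₂ ^ 2 - e₂) < 512) :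
    448 ≤ t₁ ^ 2 - e₁ + (t₂ ^ 2 - e₂) ∧ (e₁ = 0 → t₁ ^ 2 = 256) ∧ (e₂ = 0 → t₂ ^ 2 = 256) ∧ ¬ (e₁ = 0 ∧ e₂ = 0) := by
  have hb₁ : |t₁| ≤ 22 := by
    rw [abs_le]; rcases he₁ with rfl | rfl <;> rcases he₂ with rfl | rfl <;> constructor <;> nlinarith [sq_nonneg t₂]
  have hb₂ : |t₂| ≤ 22 := by
    rw [abs_le]; rcases he₁ with rfl | rfl <;> rcases he₂ with rfl | rfl <;> constructor <;> nlinarith [sq_nonneg t₁]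
  have h5₁ : 5 ≤ |t₁| := by linarith
  have h5₂ : 5 ≤ |t₂| := by linarith
  have k₁ := ts_cand t₁ e₁ c₁ he₁ hc₁ hd₁ h5₁ hb₁
  have k₂ := ts_cand t₂ e₂ c₂ he₂ hc₂ hd₂ h5₂ hb₂
  rcases k₁ with ⟨rfl, h₁⟩ | ⟨rfl, h₁⟩ <;> rcases k₂ with ⟨rfl, h₂⟩ | ⟨rfl, h₂⟩ <;>
    rcases h₁ with rfl | rfl | rfl | rfl | rfl | rfl | rfl | rfl <;>
    rcases h₂ with rfl | rfl | rfl | rfl | rfl | rfl | rfl | rfl <;>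
    revert hsum hcost <;> norm_num

/-- A multiple of `8` of square `< 64` vanishes. [folklore] -/
theorem ts_zero_of_small (t : ℤ) (h8 : (8 : ℤ) ∣ t) (h : t ^ 2 < 64) : t = 0 := by
  obtain ⟨k, rfl⟩ := h8
  have : k = 0 := by nlinarith
  subst this; ring

/-- `t² = 256 ⇒ t = ±16`. [folklore] -/
theorem ts_sq_256 (t : ℤ) (h : t ^ 2 = 256) : t = 16 ∨ t = -16 := by
  have : (t - 16) * (t + 16) = 0 := by ring_nf; linarith
  rcases mul_eq_zero.1 this with h | h
  · left; linarith
  · right; linarith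

/-! ### The window is empty -/

/-- **No cubic pair on 10 bits has `7/8 < Φ < 1`.** [this work] -/
theorem ts_window_empty (f g : (Fin (5 + 5) → Bool) → Bool) (hf : IsDegLeFun 3 f) (hg : IsDegLeFun 3 g)
    (hΦ : 7 / 8 < forrelation f g) (hΦ1 : forrelation f g < 1) : False := by
  classical
  -- both sides split
  obtain ⟨u, c, b₀, hu, hc, hc0, hunb⟩ := ten_window_derivative_unbalanced f g hf hg hΦ hΦ1
  have hΦ' : 7 / 8 < forrelation g f := by rw [forrelation_comm]; exact hΦ
  have hΦ1' : forrelation g f < 1 := by rw [forrelation_comm]; exact hΦ1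
  obtain ⟨u', c', b₀', hu', hc', hc0', -⟩ := ten_window_derivative_unbalanced g f hg hf hΦ' hΦ1'
  -- step 1 inputs
  have hro := tp_residue_odd f g hf hg hΦ u hu c b₀ hc hc0
  have hre := tp_residue_even f g hf hg hΦ u hu c b₀ hc hc0
  have hro' := tp_residue_odd g f hg hf hΦ' u' hu' c' b₀' hc' hc0'
  have hcost := tp_cost_sum_lt f g u hu hΦ c b₀ hc hc0
  have hbud' := tp_budget_lt g f u' hu' hΦ'
  -- step 3a: `S' := Σ_{L'} τ'χ' ≥ 427`
  set S' : ℤ := ∑ y ∈ univ.filter (fun y => Odd (u' y)),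
    (u' y - 2 * sZ (g y)) * (if Odd (u' y / 2) then 1 else -1) with hS'
  have hL' : ((#(univ.filter fun y : Fin (5 + 5) → Bool => Odd (u' y)) : ℕ) : ℤ) = 512 := by
    rw [← td_sum_ite_odd]; exact tp_sum_ite_odd_eq u' c' b₀' hc' hc0'
  have hS1 : 427 ≤ S' := by
    have h7 : ∀ y ∈ univ.filter (fun y => Odd (u' y)),
        (7 : ℤ) ≤ 6 * ((u' y - 2 * sZ (g y)) * (if Odd (u' y / 2) then 1 else -1)) + (u' y - 2 * sZ (g y)) ^ 2 :=
      fun y hy => ts_pair_lemma _ _ (by by_cases h : Odd (u' y / 2) <;> simp [h]) (hro' y (mem_filter.1 hy).2)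
    have hA := sum_le_sum h7
    rw [sum_const, nsmul_eq_mul, hL', sum_add_distrib, ← mul_sum] at hA
    have hB : ∑ y ∈ univ.filter (fun y => Odd (u' y)), (u' y - 2 * sZ (g y)) ^ 2 ≤ ∑ y, (u' y - 2 * sZ (g y)) ^ 2 :=
      sum_le_univ_sum_of_nonneg fun y => sq_nonneg _
    omega
  -- step 3b: adjointness `Σ_x τ ρ̂' = −32 S'`
  have hS2 : ∑ x, ((u x - 2 * sZ (f x) : ℤ) : ℝ) * W (rhoR u') x = -32 * (S' : ℝ) := by
    have e1 : ∀ x : Fin (5 + 5) → Bool, ((u x - 2 * sZ (f x) : ℤ) : ℝ) * W (rhoR u') x =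
        ∑ y, rhoR u' y * (((u x - 2 * sZ (f x) : ℤ) : ℝ) * twist x y) := by
      intro x
      rw [W, mul_sum]
      exact sum_congr rfl fun y _ => by rw [twist_comm y x]; ring
    rw [sum_congr rfl fun x _ => e1 x, sum_comm]
    simp_rw [← mul_sum, tz_fourier_link f g u u' hu hu']
    rw [hS', sum_filter]
    push_cast
    rw [mul_sum]
    refine sum_congr rfl fun y _ => ?_
    unfold rhoR chiR
    by_cases h : Odd (u' y) <;> by_cases h2 : Odd (u' y / 2) <;> simp [h, h2]
    ring
  -- step 3c: two-point support of `ρ̂'`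
  obtain ⟨x₁, x₂, hne, h1, h2, hzero⟩ := tc_two_points g f hf hΦ' u' hu' c' b₀' hc' hc0'
  have hsplit : ∑ x, ((u x - 2 * sZ (f x) : ℤ) : ℝ) * W (rhoR u') x =
      ((u x₁ - 2 * sZ (f x₁) : ℤ) : ℝ) * W (rhoR u') x₁ + ((u x₂ - 2 * sZ (f x₂) : ℤ) : ℝ) * W (rhoR u') x₂ := by
    refine sum_eq_add x₁ x₂ hne (fun x _ hx => ?_) (fun h => absurd (mem_univ _) h) (fun h => absurd (mem_univ _) h)
    rw [hzero x hx.1 hx.2, mul_zero]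
  have h27 : (27 : ℤ) ≤ |u x₁ - 2 * sZ (f x₁)| + |u x₂ - 2 * sZ (f x₂)| := by
    have hS1R : (427 : ℝ) ≤ (S' : ℝ) := by exact_mod_cast hS1
    have habs : |∑ x, ((u x - 2 * sZ (f x) : ℤ) : ℝ) * W (rhoR u') x| ≤
        |(((u x₁ - 2 * sZ (f x₁)) : ℤ) : ℝ)| * 512 + |(((u x₂ - 2 * sZ (f x₂)) : ℤ) : ℝ)| * 512 := by
      rw [hsplit]
      refine (abs_add_le _ _).trans ?_
      rw [abs_mul, abs_mul, h1, h2]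
    rw [hS2, abs_mul, abs_of_nonneg (show (0 : ℝ) ≤ (S' : ℝ) by linarith),
      show |(-32 : ℝ)| = 32 by norm_num, ← Int.cast_abs, ← Int.cast_abs] at habs
    have hR : (13664 : ℝ) ≤ ((|u x₁ - 2 * sZ (f x₁)| : ℤ) : ℝ) * 512 + ((|u x₂ - 2 * sZ (f x₂)| : ℤ) : ℝ) * 512 := by
      linarith
    have hZ : (13664 : ℤ) ≤ |u x₁ - 2 * sZ (f x₁)| * 512 + |u x₂ - 2 * sZ (f x₂)| * 512 := by
      exact_mod_cast hR
    omega
  -- step 3d: the cost table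
  have hc12 : ((u x₁ - 2 * sZ (f x₁)) ^ 2 - (if Odd (u x₁) then (1 : ℤ) else 0)) +
      ((u x₂ - 2 * sZ (f x₂)) ^ 2 - (if Odd (u x₂) then (1 : ℤ) else 0)) +
      ∑ x ∈ (univ \ {x₁, x₂}), ((u x - 2 * sZ (f x)) ^ 2 - (if Odd (u x) then (1 : ℤ) else 0)) =
      ∑ x, ((u x - 2 * sZ (f x)) ^ 2 - (if Odd (u x) then (1 : ℤ) else 0)) := by
    rw [← sum_sdiff (subset_univ {x₁, x₂}), sum_pair hne]
    ring
  have hrest_nonneg : 0 ≤ ∑ x ∈ (univ \ {x₁, x₂}), ((u x - 2 * sZ (f x)) ^ 2 - (if Odd (u x) then (1 : ℤ) else 0)) :=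
    sum_nonneg fun x _ => tp_cost_nonneg f u x
  have hd : ∀ x, (8 : ℤ) ∣ (u x - 2 * sZ (f x)) -
      (if Odd (u x) then (1 : ℤ) else 0) * (if Odd (u x / 2) then 1 else -1) := by
    intro x
    by_cases h : Odd (u x)
    · rw [if_pos h, one_mul]; exact hro x h
    · rw [if_neg h, zero_mul, sub_zero]; exact hre x h
  obtain ⟨h448, hH₁, hH₂, hnot⟩ := ts_key (u x₁ - 2 * sZ (f x₁)) (u x₂ - 2 * sZ (f x₂))
    (if Odd (u x₁) then 1 else 0) (if Odd (u x₂) then 1 else 0)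
    (if Odd (u x₁ / 2) then 1 else -1) (if Odd (u x₂ / 2) then 1 else -1)
    (by by_cases h : Odd (u x₁) <;> simp [h]) (by by_cases h : Odd (u x₂) <;> simp [h])
    (by by_cases h : Odd (u x₁ / 2) <;> simp [h]) (by by_cases h : Odd (u x₂ / 2) <;> simp [h])
    (hd x₁) (hd x₂) h27 (by linarith)
  -- every other point of `H` carries `τ = 0`
  have hrest : ∑ x ∈ (univ \ {x₁, x₂}), ((u x - 2 * sZ (f x)) ^ 2 - (if Odd (u x) then (1 : ℤ) else 0)) < 64 := by
    linarith
  have hτ0 : ∀ x, x ≠ x₁ → x ≠ x₂ → ¬ Odd (u x) → u x - 2 * sZ (f x) = 0 := by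
    intro x hx1 hx2 hx
    have hmem : x ∈ (univ \ {x₁, x₂} : Finset (Fin (5 + 5) → Bool)) := by simp [hx1, hx2]
    have hle := single_le_sum (f := fun x => (u x - 2 * sZ (f x)) ^ 2 - (if Odd (u x) then (1 : ℤ) else 0))
      (fun x _ => tp_cost_nonneg f u x) hmem
    simp only [if_neg hx, sub_zero] at hle
    exact ts_zero_of_small _ (hre x hx) (by linarith)
  -- step 4: the derivative count
  have hcount := tz_count f g u hu c b₀ hc hc0
  have hQ : ∑ x ∈ univ.filter (fun x => ¬ Odd (u x)),
      (((4 * sZ (f x) * (u x - 2 * sZ (f x)) + (u x - 2 * sZ (f x)) ^ 2 : ℤ)) : ℝ) =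
      ((if Odd (u x₁) then (0 : ℤ) else 4 * sZ (f x₁) * (u x₁ - 2 * sZ (f x₁)) + (u x₁ - 2 * sZ (f x₁)) ^ 2 : ℤ) : ℝ) +
      ((if Odd (u x₂) then (0 : ℤ) else 4 * sZ (f x₂) * (u x₂ - 2 * sZ (f x₂)) + (u x₂ - 2 * sZ (f x₂)) ^ 2 : ℤ) : ℝ) := by
    rw [sum_filter]
    rw [sum_eq_add x₁ x₂ hne (fun x _ hx => ?_) (fun h => absurd (mem_univ _) h) (fun h => absurd (mem_univ _) h)]
    · congr 1 <;> [by_cases h : Odd (u x₁); by_cases h : Odd (u x₂)] <;> simp [h]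
    · by_cases h : Odd (u x)
      · rw [if_neg (not_not.2 h)]
      · rw [if_pos h, hτ0 x hx.1 hx.2 h]; simp
  rw [hQ] at hcount
  have hs0 : signOf b₀ = 1 ∨ signOf b₀ = -1 := by unfold signOf; cases b₀ <;> simp
  have hAcases := tz_autocorr_sq g hg c
  set A : ℝ := ∑ y, signOf (g y ^^ g (bxor y c)) with hA
  -- the endgame case analysis
  by_cases ho₁ : Odd (u x₁) <;> by_cases ho₂ : Odd (u x₂)
  · -- both on `L`: no `H`-defect, `A = 0`
    rw [if_pos ho₁, if_pos ho₂] at hcount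
    push_cast at hcount
    have hA0 : A = 0 := by rcases hs0 with h | h <;> rw [h] at hcount <;> linarith
    exact hunb hA0
  · -- `x₂` on `H`
    have ht := ts_sq_256 _ (hH₂ (by simp [ho₂]))
    rw [if_pos ho₁, if_neg ho₂] at hcount
    have hsq : A ^ 2 = 9216 ∨ A ^ 2 = 25600 := by
      rcases ht with ht | ht <;> rcases tp_sZ_cases (f x₂) with hs | hs <;> rcases hs0 with h0 | h0 <;>
        · rw [ht, hs] at hcount; rw [h0] at hcount; push_cast at hcount
          first
            | exact Or.inr (by rw [show A = 160 by linarith]; norm_num)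
            | exact Or.inr (by rw [show A = -160 by linarith]; norm_num)
            | exact Or.inl (by rw [show A = 96 by linarith]; norm_num)
            | exact Or.inl (by rw [show A = -96 by linarith]; norm_num)
    rcases hAcases with hA0 | ⟨s, hs⟩
    · rw [hA0] at hsq; norm_num at hsq
    · rcases hsq with h | h
      · exact (tz_not_pow_four s).1 (by rw [← hs, h])
      · exact (tz_not_pow_four s).2 (by rw [← hs, h])
  · -- `x₁` on `H`
    have ht := ts_sq_256 _ (hH₁ (by simp [ho₁]))
    rw [if_neg ho₁, if_pos ho₂] at hcount
    have hsq : A ^ 2 = 9216 ∨ A ^ 2 = 25600 := by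
      rcases ht with ht | ht <;> rcases tp_sZ_cases (f x₁) with hs | hs <;> rcases hs0 with h0 | h0 <;>
        · rw [ht, hs] at hcount; rw [h0] at hcount; push_cast at hcount
          first
            | exact Or.inr (by rw [show A = 160 by linarith]; norm_num)
            | exact Or.inr (by rw [show A = -160 by linarith]; norm_num)
            | exact Or.inl (by rw [show A = 96 by linarith]; norm_num)
            | exact Or.inl (by rw [show A = -96 by linarith]; norm_num)
    rcases hAcases with hA0 | ⟨s, hs⟩
    · rw [hA0] at hsq; norm_num at hsq
    · rcases hsq with h | h
      · exact (tz_not_pow_four s).1 (by rw [← hs, h])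
      · exact (tz_not_pow_four s).2 (by rw [← hs, h])
  · -- both on `H`: excluded by the cost table
    exact hnot ⟨by simp [ho₁], by simp [ho₂]⟩

/-- **Isolation at `7/8` on 10 bits — second, independent proof (digit method).** For all cubic `f, g : 𝔽₂¹⁰ → 𝔽₂`,
`Φ(f,g) > 7/8 ⇒ Φ(f,g) = 1`.  Same statement as seat 1's `isolation_ten_78` (`…TenIsolation78Final.lean`, landed first);
proved here without the cell normal form, via partner rigidity and the derivative count.  Tight (`Φ = 7/8` is attained at
`n = 10`, `Negative.forrelation_fT_gT`); `7/8` is NOT the crux's global constant (`Φ = 15/16 < 1` at `n = 16`,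
`Negative/FifteenSixteenths.lean`).  HONEST FRAMING: a finite-`n` theorem / independent certification, not summit progress.
[this work] -/
theorem isolation_ten_78_digital :
    ∀ f g : (Fin (5 + 5) → Bool) → Bool, IsDegLeFun 3 f → IsDegLeFun 3 g →
      7 / 8 < forrelation f g → forrelation f g = 1 := by
  intro f g hf hg hΦ
  by_contra hne
  have hle : forrelation f g ≤ 1 := (abs_le.1 (SgnForrMem.abs_forrelation_le_one f g)).2
  exact ts_window_empty f g hf hg hΦ (lt_of_le_of_ne hle hne)

end Summit.QuantumAdvantage.QuantumAdvantage.Theorems.CubicForrelation.NearExactIsExact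

end
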